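import Summits.Ventures.PercRepro.C041ThreeExitZone
import Summits.Ventures.PercRepro.C041TwoExitCount

/-!
# ROW C-041 — THE THREE-EXIT ATTACHMENT, COUNTED (part 1): the anchor classes as conditions on the quadruple, and
the fibre counts with at least one merged exit (p6, gen 31; groundwork for the three-exit block map, mine-3's
C-041.md §20 (c), §21 (ah))

Setting of `C041ThreeExitZone`: `glue3 Z₁ u u' u'' Z a Z' a' Z'' a''`, anchor `inl (inl (inl a₁))`.  A state is a
quadruple — a colouring `ω` of `Z₁` and the states of `Z'`, `Z`, `Z''` (`stateEquiv3`); the six anchor classes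
`(c1, c2, k)` are the conditions `fibCond3` on the quadruple (`mem_Fset_iff3` … `mem_IBset_iff3`).  For a FIXED
colouring the count of triples of zone states factorises by the statuses of the three exits (`Mg` merged, `Rd`
reached, the pairwise blue connections `Mg u u'`, `Mg u'' u'`, `Mg u'' u`): a merged exit contributes its one-zone
class `cls` of the anchor class, a separated exit alone its admissible (or invalid) count `cls … false false k`,
and a BLOCK of separated exits sharing one blue sub-zone the inclusion–exclusion of its members' classes
`(F,T) / (T,F) / (T,T)`.  This part: the patterns with at least one merged exit (`card_fib3_mmm`, `card_fib3_mm_s`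
…); the patterns with no merged exit are `C041ThreeExitCountB`.
-/

namespace PercRepro

namespace ZoneZ

namespace TwoExit

open ZoneData Pendant AnchorGlue Finset

variable {V₁ E₁ U₁ U₂ V E T₁ T₂ V' E' T₁' T₂' V'' E'' T₁'' T₂'' : Type}
variable (Z₁ : ZoneData V₁ E₁ U₁ U₂) (u u' u'' : V₁) (Z : ZoneData V E T₁ T₂) (a : V)
  (Z' : ZoneData V' E' T₁' T₂') (a' : V') (Z'' : ZoneData V'' E'' T₁'' T₂'') (a'' : V'') (a₁ : V₁)

/-! ## States as quadruples -/

/-- The states of the three-exit attachment: a colouring of `Z₁` and the states of `Z'`, `Z`, `Z''`. -/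
def stateEquiv3 :
    State (((E₁ ⊕ E') ⊕ E) ⊕ E'') ((T₁' ⊕ T₁) ⊕ T₁'') ((T₂' ⊕ T₂) ⊕ T₂'') ≃
      (E₁ → Bool) × State E' T₁' T₂' × State E T₁ T₂ × State E'' T₁'' T₂'' where
  toFun σ := (col₁₃ σ, st'₃ σ, st₃ σ, st''₃ σ)
  invFun p := (Sum.elim (Sum.elim (Sum.elim p.1 p.2.1.1) p.2.2.1.1) p.2.2.2.1,
    Sum.elim (Sum.elim p.2.1.2.1 p.2.2.1.2.1) p.2.2.2.2.1,
    Sum.elim (Sum.elim p.2.1.2.2 p.2.2.1.2.2) p.2.2.2.2.2)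
  left_inv σ := by
    obtain ⟨c, m₁, m₂⟩ := σ
    refine Prod.ext ?_ (Prod.ext ?_ ?_)
    · funext e
      rcases e with ((e | e) | e) | e <;> rfl
    · funext t
      rcases t with (t | t) | t <;> rfl
    · funext t
      rcases t with (t | t) | t <;> rfl
  right_inv p := by
    obtain ⟨ω, ⟨c', m₁', m₂'⟩, ⟨c, m₁, m₂⟩, ⟨c'', m₁'', m₂''⟩⟩ := p
    rfl

/-- The equivalence, applied. -/
theorem stateEquiv3_apply (σ : State (((E₁ ⊕ E') ⊕ E) ⊕ E'') ((T₁' ⊕ T₁) ⊕ T₁'') ((T₂' ⊕ T₂) ⊕ T₂'')) :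
    stateEquiv3 σ = (col₁₃ σ, st'₃ σ, st₃ σ, st''₃ σ) := rfl

/-! ## The anchor classes as conditions on the quadruple -/

/-- The condition on a colouring `ω` of `Z₁` and states `τ'`, `τ`, `τ''` of `Z'`, `Z`, `Z''` for the corresponding
state of the three-exit attachment to lie in the anchor class `(c1, c2, k)` (`C041ThreeExitZone`: `adm₃_iff`,
`anchor₃_mem_D_iff`, `anchor₃_mem_D2_iff`, `blueK₃_iff`). -/
def fibCond3 (ω : E₁ → Bool) (c1 c2 k : Bool) (τ' : State E' T₁' T₂') (τ : State E T₁ T₂)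
    (τ'' : State E'' T₁'' T₂'') : Prop :=
  Z'.adm τ' ∧ Z.adm τ ∧ Z''.adm τ'' ∧
    ¬ (((a' ∈ Z'.D τ' ∧ Z₁.Mg u u' ω) ∨ a ∈ Z.D τ) ∧ ((a' ∈ Z'.D2 τ' ∧ Z₁.Mg u u' ω) ∨ a ∈ Z.D2 τ)) ∧
    ¬ (((a' ∈ Z'.D τ' ∧ Z₁.Mg u'' u' ω) ∨ (a ∈ Z.D τ ∧ Z₁.Mg u'' u ω) ∨ a'' ∈ Z''.D τ'') ∧
      ((a' ∈ Z'.D2 τ' ∧ Z₁.Mg u'' u' ω) ∨ (a ∈ Z.D2 τ ∧ Z₁.Mg u'' u ω) ∨ a'' ∈ Z''.D2 τ'')) ∧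
    (c1 = true → ¬ ((a' ∈ Z'.D τ' ∧ Z₁.Mg a₁ u' ω) ∨ (a ∈ Z.D τ ∧ Z₁.Mg a₁ u ω) ∨
      (a'' ∈ Z''.D τ'' ∧ Z₁.Mg a₁ u'' ω))) ∧
    (c2 = true → ¬ ((a' ∈ Z'.D2 τ' ∧ Z₁.Mg a₁ u' ω) ∨ (a ∈ Z.D2 τ ∧ Z₁.Mg a₁ u ω) ∨
      (a'' ∈ Z''.D2 τ'' ∧ Z₁.Mg a₁ u'' ω))) ∧
    (k = true → ((Z₁.Rd a₁ u' ω → Z'.blueK {a'} τ') ∧ (Z₁.Rd a₁ u ω → Z.blueK {a} τ) ∧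
      (Z₁.Rd a₁ u'' ω → Z''.blueK {a''} τ'')))

section Counts

variable [Fintype E₁] [DecidableEq E₁] [Fintype E] [DecidableEq E] [Fintype T₁] [DecidableEq T₁]
  [Fintype T₂] [DecidableEq T₂] [Fintype E'] [DecidableEq E'] [Fintype T₁'] [DecidableEq T₁']
  [Fintype T₂'] [DecidableEq T₂'] [Fintype E''] [DecidableEq E''] [Fintype T₁''] [DecidableEq T₁'']
  [Fintype T₂''] [DecidableEq T₂'']

variable (σ : State (((E₁ ⊕ E') ⊕ E) ⊕ E'') ((T₁' ⊕ T₁) ⊕ T₁'') ((T₂' ⊕ T₂) ⊕ T₂''))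

/-- `F`: the class `(T, T, F)`. -/
theorem mem_Fset_iff3 :
    σ ∈ (glue3 Z₁ u u' u'' Z a Z' a' Z'' a'').Fset (Sum.inl (Sum.inl (Sum.inl a₁))) ↔
      fibCond3 Z₁ u u' u'' Z a Z' a' Z'' a'' a₁ (col₁₃ σ) true true false (st'₃ σ) (st₃ σ) (st''₃ σ) := by
  rw [mem_Fset, adm₃_iff, anchor₃_mem_D_iff, anchor₃_mem_D2_iff]
  simp only [fibCond3, Bool.false_eq_true, false_implies, and_true, true_implies, and_assoc]

/-- `F + T₁`: the class `(F, T, F)`. -/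
theorem mem_FAset_iff3 :
    σ ∈ (glue3 Z₁ u u' u'' Z a Z' a' Z'' a'').FAset (Sum.inl (Sum.inl (Sum.inl a₁))) ↔
      fibCond3 Z₁ u u' u'' Z a Z' a' Z'' a'' a₁ (col₁₃ σ) false true false (st'₃ σ) (st₃ σ) (st''₃ σ) := by
  rw [mem_FAset, adm₃_iff, anchor₃_mem_D2_iff]
  simp only [fibCond3, Bool.false_eq_true, false_implies, and_true, true_implies, true_and, and_assoc]

/-- `F + T₂`: the class `(T, F, F)`. -/
theorem mem_FBset_iff3 :
    σ ∈ (glue3 Z₁ u u' u'' Z a Z' a' Z'' a'').FBset (Sum.inl (Sum.inl (Sum.inl a₁))) ↔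
      fibCond3 Z₁ u u' u'' Z a Z' a' Z'' a'' a₁ (col₁₃ σ) true false false (st'₃ σ) (st₃ σ) (st''₃ σ) := by
  rw [mem_FBset, adm₃_iff, anchor₃_mem_D_iff]
  simp only [fibCond3, Bool.false_eq_true, false_implies, and_true, true_implies, and_assoc]

/-- `I_F`: the class `(T, T, T)`. -/
theorem mem_IFset_iff3 :
    σ ∈ (glue3 Z₁ u u' u'' Z a Z' a' Z'' a'').IFset (Sum.inl (Sum.inl (Sum.inl a₁))) ↔
      fibCond3 Z₁ u u' u'' Z a Z' a' Z'' a'' a₁ (col₁₃ σ) true true true (st'₃ σ) (st₃ σ) (st''₃ σ) := by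
  rw [mem_IFset, adm₃_iff, anchor₃_mem_D_iff, anchor₃_mem_D2_iff, blueK₃_iff]
  simp only [fibCond3, true_implies, and_assoc]
  tauto

/-- `I_F + I₁`: the class `(F, T, T)`. -/
theorem mem_IAset_iff3 :
    σ ∈ (glue3 Z₁ u u' u'' Z a Z' a' Z'' a'').IAset (Sum.inl (Sum.inl (Sum.inl a₁))) ↔
      fibCond3 Z₁ u u' u'' Z a Z' a' Z'' a'' a₁ (col₁₃ σ) false true true (st'₃ σ) (st₃ σ) (st''₃ σ) := by
  rw [mem_IAset, adm₃_iff, anchor₃_mem_D2_iff, blueK₃_iff]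
  simp only [fibCond3, Bool.false_eq_true, false_implies, true_implies, true_and, and_assoc]
  tauto

/-- `I_F + I₂`: the class `(T, F, T)`. -/
theorem mem_IBset_iff3 :
    σ ∈ (glue3 Z₁ u u' u'' Z a Z' a' Z'' a'').IBset (Sum.inl (Sum.inl (Sum.inl a₁))) ↔
      fibCond3 Z₁ u u' u'' Z a Z' a' Z'' a'' a₁ (col₁₃ σ) true false true (st'₃ σ) (st₃ σ) (st''₃ σ) := by
  rw [mem_IBset, adm₃_iff, anchor₃_mem_D_iff, blueK₃_iff]
  simp only [fibCond3, Bool.false_eq_true, false_implies, true_implies, true_and, and_assoc]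
  tauto

open Classical in
/-- The fibre of the class `(c1, c2, k)` over the colouring `ω`: the triples of zone states satisfying
`fibCond3`. -/
noncomputable def fib3 (ω : E₁ → Bool) (c1 c2 k : Bool) :
    Finset (State E' T₁' T₂' × State E T₁ T₂ × State E'' T₁'' T₂'') :=
  univ.filter fun p => fibCond3 Z₁ u u' u'' Z a Z' a' Z'' a'' a₁ ω c1 c2 k p.1 p.2.1 p.2.2

omit [Fintype E₁] [DecidableEq E₁] in
/-- Membership in a fibre. -/
theorem mem_fib3 (ω : E₁ → Bool) (c1 c2 k : Bool) (p : State E' T₁' T₂' × State E T₁ T₂ × State E'' T₁'' T₂'') :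
    p ∈ fib3 Z₁ u u' u'' Z a Z' a' Z'' a'' a₁ ω c1 c2 k ↔
      fibCond3 Z₁ u u' u'' Z a Z' a' Z'' a'' a₁ ω c1 c2 k p.1 p.2.1 p.2.2 := by
  classical
  unfold fib3
  rw [Finset.mem_filter]
  exact and_iff_right (Finset.mem_univ _)

/-! ## The fibre counts: at least one merged exit -/

omit [Fintype E₁] [DecidableEq E₁] in
/-- **All three exits merged**: the product of the three one-zone classes (`c1` or `c2`). -/
theorem card_fib3_mmm (ω : E₁ → Bool) (hm : Z₁.Mg a₁ u ω) (hm' : Z₁.Mg a₁ u' ω) (hm'' : Z₁.Mg a₁ u'' ω)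
    (c1 c2 k : Bool) (hc : c1 = true ∨ c2 = true) :
    #(fib3 Z₁ u u' u'' Z a Z' a' Z'' a'' a₁ ω c1 c2 k) =
      #(cls Z' a' c1 c2 k (Z₁.Rd a₁ u' ω)) * (#(cls Z a c1 c2 k (Z₁.Rd a₁ u ω)) *
        #(cls Z'' a'' c1 c2 k (Z₁.Rd a₁ u'' ω))) := by
  have hbc := Mg_exits_of_merged Z₁ u u' a₁ ω hm hm'
  have hbc' := Mg_exits_of_merged Z₁ u'' u' a₁ ω hm'' hm'
  have hbc'' := Mg_exits_of_merged Z₁ u'' u a₁ ω hm'' hm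
  have e : fib3 Z₁ u u' u'' Z a Z' a' Z'' a'' a₁ ω c1 c2 k =
      cls Z' a' c1 c2 k (Z₁.Rd a₁ u' ω) ×ˢ (cls Z a c1 c2 k (Z₁.Rd a₁ u ω) ×ˢ
        cls Z'' a'' c1 c2 k (Z₁.Rd a₁ u'' ω)) := by
    ext p
    rw [mem_fib3, Finset.mem_product, Finset.mem_product, mem_cls, mem_cls, mem_cls]
    simp only [fibCond3, hm, hm', hm'', hbc, hbc', hbc'', and_true]
    rcases hc with rfl | rfl <;> simp only [true_implies, not_or] <;> aesop
  rw [e, Finset.card_product, Finset.card_product]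

omit [Fintype E₁] [DecidableEq E₁] in
/-- **`u`, `u'` merged, `u''` separated**: the two classes times the admissible (or invalid) count of `Z''`. -/
theorem card_fib3_mm_s (ω : E₁ → Bool) (hm : Z₁.Mg a₁ u ω) (hm' : Z₁.Mg a₁ u' ω) (hm'' : ¬ Z₁.Mg a₁ u'' ω)
    (c1 c2 k : Bool) (hc : c1 = true ∨ c2 = true) :
    #(fib3 Z₁ u u' u'' Z a Z' a' Z'' a'' a₁ ω c1 c2 k) =
      #(cls Z' a' c1 c2 k (Z₁.Rd a₁ u' ω)) * (#(cls Z a c1 c2 k (Z₁.Rd a₁ u ω)) *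
        #(cls Z'' a'' false false k (Z₁.Rd a₁ u'' ω))) := by
  have hbc := Mg_exits_of_merged Z₁ u u' a₁ ω hm hm'
  have hbc' := not_Mg_exits_of_sep_merged Z₁ u'' u' a₁ ω hm'' hm'
  have hbc'' := not_Mg_exits_of_sep_merged Z₁ u'' u a₁ ω hm'' hm
  have e : fib3 Z₁ u u' u'' Z a Z' a' Z'' a'' a₁ ω c1 c2 k =
      cls Z' a' c1 c2 k (Z₁.Rd a₁ u' ω) ×ˢ (cls Z a c1 c2 k (Z₁.Rd a₁ u ω) ×ˢ
        cls Z'' a'' false false k (Z₁.Rd a₁ u'' ω)) := by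
    ext p
    rw [mem_fib3, Finset.mem_product, Finset.mem_product, mem_cls, mem_cls, mem_cls]
    simp only [fibCond3, hm, hm', hm'', hbc, hbc', hbc'', and_true, and_false, false_or,
      Bool.false_eq_true, false_implies, true_and]
    have h3 := Z''.not_mem_D_of_mem_D2 a'' p.2.2
    rcases hc with rfl | rfl <;> simp only [true_implies, not_or] <;> aesop
  rw [e, Finset.card_product, Finset.card_product]

omit [Fintype E₁] [DecidableEq E₁] in
/-- **`u`, `u''` merged, `u'` separated**. -/
theorem card_fib3_m_s_m (ω : E₁ → Bool) (hm : Z₁.Mg a₁ u ω) (hm' : ¬ Z₁.Mg a₁ u' ω) (hm'' : Z₁.Mg a₁ u'' ω)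
    (c1 c2 k : Bool) (hc : c1 = true ∨ c2 = true) :
    #(fib3 Z₁ u u' u'' Z a Z' a' Z'' a'' a₁ ω c1 c2 k) =
      #(cls Z' a' false false k (Z₁.Rd a₁ u' ω)) * (#(cls Z a c1 c2 k (Z₁.Rd a₁ u ω)) *
        #(cls Z'' a'' c1 c2 k (Z₁.Rd a₁ u'' ω))) := by
  have hbc := not_Mg_exits_of_merged_sep Z₁ u u' a₁ ω hm hm'
  have hbc' := not_Mg_exits_of_merged_sep Z₁ u'' u' a₁ ω hm'' hm'
  have hbc'' := Mg_exits_of_merged Z₁ u'' u a₁ ω hm'' hm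
  have e : fib3 Z₁ u u' u'' Z a Z' a' Z'' a'' a₁ ω c1 c2 k =
      cls Z' a' false false k (Z₁.Rd a₁ u' ω) ×ˢ (cls Z a c1 c2 k (Z₁.Rd a₁ u ω) ×ˢ
        cls Z'' a'' c1 c2 k (Z₁.Rd a₁ u'' ω)) := by
    ext p
    rw [mem_fib3, Finset.mem_product, Finset.mem_product, mem_cls, mem_cls, mem_cls]
    simp only [fibCond3, hm, hm', hm'', hbc, hbc', hbc'', and_true, and_false, false_or,
      Bool.false_eq_true, false_implies, true_and]
    have h1 := Z'.not_mem_D_of_mem_D2 a' p.1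
    rcases hc with rfl | rfl <;> simp only [true_implies, not_or] <;> aesop
  rw [e, Finset.card_product, Finset.card_product]

omit [Fintype E₁] [DecidableEq E₁] in
/-- **`u'`, `u''` merged, `u` separated**. -/
theorem card_fib3_s_mm (ω : E₁ → Bool) (hm : ¬ Z₁.Mg a₁ u ω) (hm' : Z₁.Mg a₁ u' ω) (hm'' : Z₁.Mg a₁ u'' ω)
    (c1 c2 k : Bool) (hc : c1 = true ∨ c2 = true) :
    #(fib3 Z₁ u u' u'' Z a Z' a' Z'' a'' a₁ ω c1 c2 k) =
      #(cls Z' a' c1 c2 k (Z₁.Rd a₁ u' ω)) * (#(cls Z a false false k (Z₁.Rd a₁ u ω)) *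
        #(cls Z'' a'' c1 c2 k (Z₁.Rd a₁ u'' ω))) := by
  have hbc := not_Mg_exits_of_sep_merged Z₁ u u' a₁ ω hm hm'
  have hbc' := Mg_exits_of_merged Z₁ u'' u' a₁ ω hm'' hm'
  have hbc'' := not_Mg_exits_of_merged_sep Z₁ u'' u a₁ ω hm'' hm
  have e : fib3 Z₁ u u' u'' Z a Z' a' Z'' a'' a₁ ω c1 c2 k =
      cls Z' a' c1 c2 k (Z₁.Rd a₁ u' ω) ×ˢ (cls Z a false false k (Z₁.Rd a₁ u ω) ×ˢ
        cls Z'' a'' c1 c2 k (Z₁.Rd a₁ u'' ω)) := by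
    ext p
    rw [mem_fib3, Finset.mem_product, Finset.mem_product, mem_cls, mem_cls, mem_cls]
    simp only [fibCond3, hm, hm', hm'', hbc, hbc', hbc'', and_true, and_false, false_or,
      Bool.false_eq_true, false_implies, true_and]
    have h2 := Z.not_mem_D_of_mem_D2 a p.2.1
    rcases hc with rfl | rfl <;> simp only [true_implies, not_or] <;> aesop
  rw [e, Finset.card_product, Finset.card_product]

omit [Fintype E₁] [DecidableEq E₁] in
/-- **`u` merged, `u'`, `u''` separated and apart**. -/
theorem card_fib3_m_s_s (ω : E₁ → Bool) (hm : Z₁.Mg a₁ u ω) (hm' : ¬ Z₁.Mg a₁ u' ω) (hm'' : ¬ Z₁.Mg a₁ u'' ω)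
    (hbc' : ¬ Z₁.Mg u'' u' ω) (c1 c2 k : Bool) :
    #(fib3 Z₁ u u' u'' Z a Z' a' Z'' a'' a₁ ω c1 c2 k) =
      #(cls Z' a' false false k (Z₁.Rd a₁ u' ω)) * (#(cls Z a c1 c2 k (Z₁.Rd a₁ u ω)) *
        #(cls Z'' a'' false false k (Z₁.Rd a₁ u'' ω))) := by
  have hbc := not_Mg_exits_of_merged_sep Z₁ u u' a₁ ω hm hm'
  have hbc'' := not_Mg_exits_of_sep_merged Z₁ u'' u a₁ ω hm'' hm
  have e : fib3 Z₁ u u' u'' Z a Z' a' Z'' a'' a₁ ω c1 c2 k =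
      cls Z' a' false false k (Z₁.Rd a₁ u' ω) ×ˢ (cls Z a c1 c2 k (Z₁.Rd a₁ u ω) ×ˢ
        cls Z'' a'' false false k (Z₁.Rd a₁ u'' ω)) := by
    ext p
    rw [mem_fib3, Finset.mem_product, Finset.mem_product, mem_cls, mem_cls, mem_cls]
    simp only [fibCond3, hm, hm', hm'', hbc, hbc', hbc'', and_true, and_false, false_or, or_false,
      Bool.false_eq_true, false_implies, true_and]
    have h1 := Z'.not_mem_D_of_mem_D2 a' p.1
    have h2 := Z.not_mem_D_of_mem_D2 a p.2.1
    have h3 := Z''.not_mem_D_of_mem_D2 a'' p.2.2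
    aesop
  rw [e, Finset.card_product, Finset.card_product]

omit [Fintype E₁] [DecidableEq E₁] in
/-- **`u` merged, `u'`, `u''` separated in ONE sub-zone**: the class of `Z` times the inclusion–exclusion of the
block `{u', u''}`. -/
theorem card_fib3_m_joint (ω : E₁ → Bool) (hm : Z₁.Mg a₁ u ω) (hm' : ¬ Z₁.Mg a₁ u' ω) (hm'' : ¬ Z₁.Mg a₁ u'' ω)
    (hbc' : Z₁.Mg u'' u' ω) (c1 c2 k : Bool) :
    #(fib3 Z₁ u u' u'' Z a Z' a' Z'' a'' a₁ ω c1 c2 k) +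
        #(cls Z' a' true true k (Z₁.Rd a₁ u' ω)) * (#(cls Z a c1 c2 k (Z₁.Rd a₁ u ω)) *
          #(cls Z'' a'' true true k (Z₁.Rd a₁ u'' ω))) =
      #(cls Z' a' false true k (Z₁.Rd a₁ u' ω)) * (#(cls Z a c1 c2 k (Z₁.Rd a₁ u ω)) *
          #(cls Z'' a'' false true k (Z₁.Rd a₁ u'' ω))) +
        #(cls Z' a' true false k (Z₁.Rd a₁ u' ω)) * (#(cls Z a c1 c2 k (Z₁.Rd a₁ u ω)) *
          #(cls Z'' a'' true false k (Z₁.Rd a₁ u'' ω))) := by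
  classical
  have hbc := not_Mg_exits_of_merged_sep Z₁ u u' a₁ ω hm hm'
  have hbc'' := not_Mg_exits_of_sep_merged Z₁ u'' u a₁ ω hm'' hm
  have e : fib3 Z₁ u u' u'' Z a Z' a' Z'' a'' a₁ ω c1 c2 k =
      cls Z' a' false true k (Z₁.Rd a₁ u' ω) ×ˢ (cls Z a c1 c2 k (Z₁.Rd a₁ u ω) ×ˢ
          cls Z'' a'' false true k (Z₁.Rd a₁ u'' ω)) ∪
        cls Z' a' true false k (Z₁.Rd a₁ u' ω) ×ˢ (cls Z a c1 c2 k (Z₁.Rd a₁ u ω) ×ˢ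
          cls Z'' a'' true false k (Z₁.Rd a₁ u'' ω)) := by
    ext p
    rw [mem_fib3, Finset.mem_union, Finset.mem_product, Finset.mem_product, Finset.mem_product,
      Finset.mem_product]
    simp only [mem_cls]
    simp only [fibCond3, hm, hm', hm'', hbc, hbc', hbc'', and_true, and_false, false_or, or_false,
      Bool.false_eq_true, false_implies, true_and, true_implies]
    have h1 := Z'.not_mem_D_of_mem_D2 a' p.1
    have h2 := Z.not_mem_D_of_mem_D2 a p.2.1
    have h3 := Z''.not_mem_D_of_mem_D2 a'' p.2.2
    rcases Classical.em (a' ∈ Z'.D p.1) with hD' | hD' <;> rcases Classical.em (a'' ∈ Z''.D p.2.2) with hD'' | hD'' <;>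
      aesop
  have e2 : cls Z' a' false true k (Z₁.Rd a₁ u' ω) ×ˢ (cls Z a c1 c2 k (Z₁.Rd a₁ u ω) ×ˢ
          cls Z'' a'' false true k (Z₁.Rd a₁ u'' ω)) ∩
        cls Z' a' true false k (Z₁.Rd a₁ u' ω) ×ˢ (cls Z a c1 c2 k (Z₁.Rd a₁ u ω) ×ˢ
          cls Z'' a'' true false k (Z₁.Rd a₁ u'' ω)) =
      cls Z' a' true true k (Z₁.Rd a₁ u' ω) ×ˢ (cls Z a c1 c2 k (Z₁.Rd a₁ u ω) ×ˢ
          cls Z'' a'' true true k (Z₁.Rd a₁ u'' ω)) := by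
    ext p
    rw [Finset.mem_inter, Finset.mem_product, Finset.mem_product, Finset.mem_product, Finset.mem_product,
      Finset.mem_product, Finset.mem_product]
    simp only [mem_cls, Bool.false_eq_true, false_implies, true_implies, true_and]
    tauto
  rw [e, ← Finset.card_product, ← Finset.card_product, ← Finset.card_product, ← Finset.card_product,
    ← Finset.card_product, ← Finset.card_product, ← e2, Finset.card_union_add_card_inter]

end Counts

end TwoExit

end ZoneZ

end PercRepro
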